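import Literature.MathematicalPhysics.QuantumFieldTheory.Balaban1983to89.B9Thm312WholeLeafCompleteNbr
import Literature.MathematicalPhysics.QuantumFieldTheory.Balaban1983to89.B9Thm312WholeBlocksNbrRec

/-!
# `Balaban1983to89.B9Thm312WholeLeafCompleteNbrRec` — [B9] Theorem 3.12 (p. 423) AS THE WHOLE PRINTED LEAF `B9.Thm312Printed` AT THE PINS WITH NO
# DISPLAYED RESIDUAL, NEIGHBOURHOOD-SITED CO-READINGS IN THE RECORD'S INDEX ORDER (K.l2 3 = the mixed member ∇_UA∇\*_U, K.l2 4 = the pair family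
# ∇_ν∇_μA), transposition letters under the (3.35)∕(3.36) prefix — THE ROW-20 LEAF FOR THE KNIT AT `Node00.kernelFamilyB`

T. Bałaban, *Propagators for lattice gauge theories in a background field*, Commun. Math. Phys. **99** (1985) 389–434
[`Balaban1985BackgroundPropagators`, "B9"]; [4] = T. Bałaban, *Propagators and renormalization transformations for lattice
gauge theories. II*, Commun. Math. Phys. **96** (1984) 223–250 [`Balaban1984PropagatorsII`].

statement-level skeleton of published theorems with citation tags; proofs where landed; nothing here is a claim about the
Yang–Mills mass gap

THE PRINTED LOCI are those of `…B9Thm312WholeLeafRelH`, `…B9Thm312WholeBlocksNbr` and `…B9Thm312WholeHHolderNbr` (verbatim there).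

WHY THIS FILE (successor of `…B9Thm312WholeLeafComplete.thm312Printed_complete`, same seat).  That leaf reads the (3.43)–(3.46) quantities of
`GD i`, `G₁ i` through `L2ReadsRel` ∕ `H1ReadsRel` ∕ `InputReadsRel` and the Hölder member of (3.133) through `CoReadsHHolderRel` — schemas whose
observation is sited on the CLASS of y and which are NOT dischargeable at the record geometry (n06-k's located obstructions (O1)∕(O2), kernel
negative `B9RWSumsReadsRelNegative.not_l2ReadsRel_evBK`), so at the instance those binders could only be carried vacuously.  THIS FILE proves
the same residual-free leaf with those four co-reading families replaced by their NEIGHBOURHOOD-SITED re-typings `B9RWSumsReadsNbr.L2ReadsNbr` ∕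
`H1ReadsNbr` ∕ `InputReadsNbr` (the species n06-d discharges at the record, `B9CoReadingCoordsL2.l2ReadsNbr_kernelFamilyB_coords_*`) and
`B9Thm312WholeHHolderNbr.CoReadsHHolderNbr`, and with the two second-order L² lines modelled print-faithfully by the direction-pair families
∇_{U,ν}∇_{U,μ}A, A∇\*_{U,ν}∇\*_{U,μ} packaged by `familyOp` (letters `Dd Dds`, schema `Thm33G0L2P`).  ROUTE: the landed leaf
`B9Thm312WholeLeafRelH.thm312Printed_of_stepRelH` (whose remaining co-readings `CoRealizesRel` ∕ `CoReadsGlob` ∕ `CoRealizesHRel` are the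
dischargeable species of n06-d's `B9CoReadingCoords*`) is fed, as its residual `hres`, the two typed blocks `L2Block K … U ∧ B9.Ineq343_345 K … U`
for K ∈ [G_D, G₁] from `B9Thm312WholeBlocksNbr.l2Block_of_step_nbr` ∕ `holder_of_step_nbr` and the Hölder member of (3.133) for H, H₁ from
`B9Thm312WholeHHolderNbr.hkh_of_step_nbr`, per member and per configuration, weakened to uniform constants (threshold max(M₁, M_L, M_L′),
smallness min(a₁, (2(θ₁c + 1))⁻¹, (2(B₂θ₂c² + 1))⁻¹), rate ρ_f).

THIS VARIANT (successor of `…B9Thm312WholeLeafCompleteNbrReg.thm312Printed_completeNbrReg`, same seat, same day; referee ref-A's located point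
IDX34).  PRINT (3.46) p. 398 lists the six L² members as n = 0 G′, 1 ∇_UG′, 2 G′∇\*_U, 3 ∇_U∇_UG′, 4 ∇_UG′∇\*_U, 5 G′∇\*_U∇\*_U; the RECORD's kernel
families (`Node00.kernelFamilyS.l2`, `kernelFamilyB.l2`) order them n = 0 O, 1 ∇O, 2 O∇\*, **3 ∇_νO∇\*_μ (mixed), 4 ∇_ν∇_μO, 5 O∇\*_ν∇\*_μ** — a
permutation, content-neutral for the node statement (all n, weights [t², t, t, 1, 1, 1]) but NOT for the index-specific co-reading binders
`L2ReadsNbr K n … T`: the predecessors bind the print order (index 3 ↦ the pair family on `blk ∘ Prod.fst`, index 4 ↦ the mixed composite on the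
lattice Y), which the record cannot feed.  THIS FILE re-proves the leaf with the two co-readings EXCHANGED — `hl2N`'s index 3 is the mixed
∇_UA∇\*_U on `blkY blkY evY`, index 4 the pair family `familyOp (q ↦ ∇_{q.1}∇_{q.2}∘A)` on `blk ∘ Prod.fst` — through
`B9Thm312WholeBlocksNbrRec.l2Block_of_step_nbrRec`; everything else is verbatim (`constL2N_le` imported from `…LeafCompleteNbr`).

WHAT THIS FILE PROVES: ★★ `thm312Printed_completeNbrRec` (0 `def`, 0 named fact, 0 sorry).
New binders versus `thm312Printed_complete`: the radius `r`, the evaluation constant `Cev ≧ 0`, the neighbourhood count `mN`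
(`(nbr (geo i) r y).card ≤ mN`), the level comparability `CL ≧ 1` (`d(a,a′) ≤ r ⇒ Lʲ⁽ᵃ⁾η ≤ CL·Lʲ⁽ᵃ′⁾η`), the direction type `P` with the letters
`Dd Dds`; `Lap` and the second-argument saturation `hRdist'` are gone (the latter follows from `hRdist` and the symmetry of d).

HONEST SCOPE.  Nothing of print is asserted; every schema is a HYPOTHESIS of printed shape whose derivation (located gap G-B9-16) is not typed;
kernel-checked bookkeeping — NOT a node discharge, NOT summit progress; one finite lattice at a time; nothing continuum, nothing about the mass
gap.  Cell `pub-ymgap` (HUMAN RULING D-0062), Track A node N06 [B9], N06-ASSIGNMENT v1 row 20 (bundle F7), seat `pub-ymgap-dag-n06-l` (g5),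
2026-08-27 (second filing of the day).
-/

namespace Literature.MathematicalPhysics.QuantumFieldTheory.Balaban1983to89.B9Thm312WholeLeafCompleteNbrRec

open Literature.MathematicalPhysics.QuantumFieldTheory.Balaban1983to89
open Finset B6RandomWalk B6RandomWalkHom B9Thm34Ext B9Thm37Glue B9Thm37GlueCor36 B11SectG B9SectDSup B9SectDL2Decay
open B9Thm37AllNorms B9Thm37AllNormsInstances B9FromB6 B9FromB6ModelSignsOn B9SectBStepWhole B9Thm312Whole B9Thm312WholeLeaf
open B9Thm312WholeLeft B9Thm312WholeH B9Thm312WholeLeafLeftGlob B9Ineq347CoReading B9SectCDiffDict B9CoRealizesRel B9CoRealizesHRel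
open B9RWSums343Holder B9RWSumsReadsRel B9RWSumsReadsNbr B9Ineq347 B9Thm312WholeClasses B9Thm312WholeHolder B9Thm312WholeL2
open B9Thm312WholeBlocksRel B9Thm312WholeBlocksNbr B9Thm312WholeLeafAll B9Thm312WholeHHolder B9Thm312WholeHHolderNbr B9Thm312WholeLeafRelH
open B9RWSums346SecondDiff B9Thm312WholeLeafCompleteNbr B9Thm312WholeBlocksNbrRec

noncomputable section


/-! ## The leaf of row 20 with no displayed residual, neighbourhood-sited co-readings -/

section Family

variable {I : Type} {d : ℕ} {c35 : ℝ} {geo : I → B9.Geometry} {bg : I → B9.Backgrounds}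
variable [∀ i, Fintype (geo i).Site] [∀ i, DecidableEq (geo i).Site]
variable {X Y Z W PX PY : I → Type} {P : Type} [∀ i, Fintype (X i)] [∀ i, DecidableEq (X i)] [∀ i, Fintype (Y i)]
  [∀ i, Fintype (Z i)] [∀ i, Fintype (W i)] [∀ i, Fintype (PX i)] [∀ i, Fintype (PY i)] [Fintype P]

omit [∀ i, Fintype (X i)] [∀ i, DecidableEq (X i)] [∀ i, Fintype (Y i)] [∀ i, Fintype (Z i)] [∀ i, Fintype (W i)]
  [∀ i, Fintype (geo i).Site] [∀ i, DecidableEq (geo i).Site] [∀ i, Fintype (PX i)] [∀ i, Fintype (PY i)] [Fintype P] in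
/-- Arithmetic of *"for α₀ sufficiently small"*: t ≧ 0 and m ≦ (2(t + 1))⁻¹ give tm ≦ ½. [folklore] -/
private theorem small_aux₁₃ {t m : ℝ} (ht : 0 ≤ t) (hm : m ≤ (2 * (t + 1))⁻¹) : t * m ≤ 1 / 2 := by
  have hpos : 0 < 2 * (t + 1) := by linarith
  have h1 : t * m ≤ t * (2 * (t + 1))⁻¹ := mul_le_mul_of_nonneg_left hm ht
  have h2 : t * (2 * (t + 1))⁻¹ ≤ 1 / 2 := by
    rw [← div_eq_mul_inv, div_le_iff₀ hpos]
    linarith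
  linarith

-- heartbeat budget (v1.1, pre-emptive): this one-block proof elaborates at ≈ 130–160k heartbeats on the farm — the band in which two
-- sibling leaves failed `lake build` at the 200k default (2026-08-27); statement and proof byte-identical to v1.
set_option maxHeartbeats 400000 in
/-- ★★ **THEOREM 3.12 AS THE WHOLE PRINTED LEAF `B9.Thm312Printed`, AT THE PINS — NO DISPLAYED RESIDUAL, NEIGHBOURHOOD-SITED CO-READINGS IN THE
RECORD'S INDEX ORDER, TRANSPOSITION LETTERS UNDER THE (3.35)∕(3.36) PREFIX** (p. 423; `thm312Printed_completeNbrReg` with the `L2ReadsNbr` binders of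
indices 3 and 4 exchanged: 3 = the mixed ∇_UA∇\*_U, 4 = the pair family ∇_ν∇_μA).
Inputs: those of `B9Thm312WholeLeafComplete.thm312Printed_complete` with the four class-sited co-reading families replaced by their
neighbourhood-sited re-typings — `hl2N` (`L2ReadsNbr` ×6 for G_D, ×6 for G₁; lines 3∕5 by the packaged pair families
`familyOp (q ↦ ∇_{q.1}∇_{q.2}∘A)`, `familyOp (q ↦ A∘∇\*_{q.1}∇\*_{q.2})` into X × (P × P), block map `blk ∘ Prod.fst`), `hH1N` (`H1ReadsNbr` ×2), `hIN`
(`InputReadsNbr` ×2), `hHCN` (`CoReadsHHolderNbr` ×2) — the direction letters `Dd Dds` with Theorem 3.3 for G₀ in the pair-indexed L² classes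
(`hG0C : Thm33G0H ∧ Thm33G0L2P`), and the neighbourhood data (radius r, evaluation constant Cev ≧ 0, count mN, level comparability CL ≧ 1).  PROVED
INSIDE: every member — (3.42)₁,₂,₃, (3.46)₀₋₅, (3.43)–(3.45), (3.47)₀,₁,₂ for G_D, G₁; all three members of (3.133) for H, H₁; Theorem 3.11; the pins.
Route: `thm312Printed_of_stepRelH` with the threshold max(M₁, M_L, M_L′), the smallness min(a₁, (2(θ₁c + 1))⁻¹, (2(B₂θ₂c² + 1))⁻¹) and `hres`
supplied by `B9Thm312WholeBlocksNbr.l2Block_of_step_nbr` ∕ `holder_of_step_nbr` (twice per member) and `B9Thm312WholeHHolderNbr.hkh_of_step_nbr`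
(for H and H₁) at uniform constants and the rate ρ_f.  Nothing of print asserted; NOT a node discharge.
[cite: Balaban1985BackgroundPropagators, Thm 3.12 pp.421–423 + (3.39)–(3.47) pp.397–398 + (3.126) p.420 + (3.129) p.421 + (3.132)–(3.133) p.422; Balaban1984PropagatorsII, (2.51)–(2.52) p.232 + Lemma 2.1 (2.60)–(2.61) p.234] -/
theorem thm312Printed_completeNbrRec (𝔬 : ∀ i, Ops (geo i) (bg i) (X i) (Y i) (Z i) (W i)) (R₀ : I → ℝ) (H₀ : I → Prop)
    (𝔭 : ∀ i, HolderProbes (geo i) (bg i) (X i) (Y i) (PX i) (PY i))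
    (bH : ∀ i, ℝ → BlockNorm (toB6 (geo i) (R₀ i) (H₀ i)) (Y i → ℝ))
    (Dd Dds : ∀ i, (bg i).Cfg → P → Module.End ℝ (X i → ℝ))
    (GD G₁ : ∀ i, B9.KernelFamily (geo i) (bg i)) (Hk H₁k : ∀ i, B9.HKernel (geo i) (bg i))
    (ev : ∀ i, (geo i).Loc → X i → ℝ) (evY : ∀ i, (geo i).Loc → Y i → ℝ) {PL : ∀ i, (geo i).Loc → Prop}
    (Rel : ∀ i, (geo i).Site → (geo i).Site → Prop) [∀ i, DecidableRel (Rel i)] (m mN : ℕ)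
    (r Cev CL θ₁ θD θH θ₂ r₁ B₀ B₂ δ₀ δK σ c ρ ρf a₁ M₁ ML B₃ δ₃ α Lc : ℝ) (Bh Bi Bq : ℝ → ℝ) (Bi2 : ℝ → ℝ → ℝ)
    (hθ₁ : 0 ≤ θ₁) (hθD : 0 ≤ θD) (hθH : 0 ≤ θH) (hθ₂ : 0 ≤ θ₂) (hr₁ : 0 ≤ r₁) (hB₀ : 0 ≤ B₀) (hB₂ : 0 ≤ B₂) (hB₃ : 0 ≤ B₃)
    (hσ : 0 ≤ σ) (hρ : 0 < ρ) (hρS : ρ ≤ δ₀) (hρδ : ρ + σ ≤ δK) (hρ₃ : ρ + σ ≤ δ₃) (hc : 0 ≤ c) (ha₁ : 0 < a₁) (hM₁ : 0 < M₁)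
    (hα : α ≤ 1 / 2) (hα0 : 0 ≤ α) (hρf : 0 < ρf) (hρf1 : ρf + σ ≤ (1 - α) * ρ) (hρf2 : ρf + 2 * σ + α * ρ ≤ ρ)
    (hBh : ∀ β, 0 ≤ β → β < 1 → 0 ≤ Bh β) (hBi : ∀ ε, 0 < ε → ε ≤ 1 → 0 ≤ Bi ε)
    (hBi2 : ∀ ε β, 0 < ε → ε ≤ 1 → 0 ≤ β → β < 1 → 0 ≤ Bi2 ε β) (hBq : ∀ β, 0 ≤ Bq β)
    (hCev : 0 ≤ Cev) (hCL1 : 1 ≤ CL)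
    (hgeo : ∀ i, GeoOK (geo i)) (S : ∀ i, ModelSignsOn (geo i) (PL i))
    (hL1 : ∀ i, 1 ≤ (geo i).L) (hLle : ∀ i, (geo i).L ≤ Lc) (hLc : 1 ≤ Lc) (hη : ∀ i, 0 < (geo i).eta)
    (hrow : ∀ i, ML ≤ (geo i).M → RowSum (toB6 (geo i) (R₀ i) (H₀ i)) σ c)
    (hL21 : ∀ δ : ℝ, 0 < δ → ∃ ML' c' : ℝ, Lemma21AboveG geo R₀ H₀ δ α ML' c')
    (hnbr : ∀ (i : I) (y : (geo i).Site), (nbr (geo i) r y).card ≤ mN)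
    (hCL : ∀ (i : I) (a a' : (geo i).Site), (geo i).dist a a' ≤ r → (geo i).len a ≤ CL * (geo i).len a')
    (hsat : ∀ (i : I) (n : Fin 4) (B' δ' : ℝ),
      (∀ a a' b, Rel i a a' → maj342 (geo i) n B' δ' a b = maj342 (geo i) n B' δ' a' b) ∧
      (∀ a b b', Rel i b b' → maj342 (geo i) n B' δ' a b = maj342 (geo i) n B' δ' a b'))
    (hmult : ∀ (i : I) (y' : (geo i).Site), (Finset.univ.filter (fun y'' => Rel i y'' y')).card ≤ m)
    (hRdist : ∀ (i : I) (a a' b : (geo i).Site), Rel i a a' → (geo i).dist a b = (geo i).dist a' b)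
    (hRlen : ∀ (i : I) (a a' : (geo i).Site), Rel i a a' → (geo i).len a = (geo i).len a')
    (hcoR : ∀ (i : I) (U : (bg i).Cfg),
      CoRealizesRel (GD i) 0 U (Rel i) (𝔬 i).blk (𝔬 i).blk (ev i) ((𝔬 i).G U) ∧
      CoRealizesRel (GD i) 2 U (Rel i) (𝔬 i).blk (𝔬 i).blkY (evY i) ((𝔬 i).G U ∘ₗ (𝔬 i).Dstar U) ∧
      CoRealizesRel (G₁ i) 0 U (Rel i) (𝔬 i).blk (𝔬 i).blk (ev i) ((𝔬 i).G1 U) ∧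
      CoRealizesRel (G₁ i) 2 U (Rel i) (𝔬 i).blk (𝔬 i).blkY (evY i) ((𝔬 i).G1 U ∘ₗ (𝔬 i).Dstar U))
    (hco1R : ∀ (i : I) (U : (bg i).Cfg),
      CoRealizesRel (GD i) 1 U (Rel i) (𝔬 i).blkY (𝔬 i).blk (ev i) ((𝔬 i).D U ∘ₗ (𝔬 i).G U) ∧
      CoRealizesRel (G₁ i) 1 U (Rel i) (𝔬 i).blkY (𝔬 i).blk (ev i) ((𝔬 i).D U ∘ₗ (𝔬 i).G1 U))
    (hcoHR : ∀ (i : I) (U : (bg i).Cfg),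
      CoRealizesHRel (Hk i) 0 U d (Rel i) (𝔬 i).blk (𝔬 i).blkZ ((𝔬 i).Hm U) ∧
      CoRealizesHRel (Hk i) 1 U d (Rel i) (𝔬 i).blkY (𝔬 i).blkZ ((𝔬 i).D U ∘ₗ (𝔬 i).Hm U) ∧
      CoRealizesHRel (H₁k i) 0 U d (Rel i) (𝔬 i).blk (𝔬 i).blkZ ((𝔬 i).H1m U) ∧
      CoRealizesHRel (H₁k i) 1 U d (Rel i) (𝔬 i).blkY (𝔬 i).blkZ ((𝔬 i).D U ∘ₗ (𝔬 i).H1m U))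
    (hcoG : ∀ (i : I) (U : (bg i).Cfg),
      CoReadsGlob (GD i) 0 U (𝔬 i).blk (𝔬 i).blk (ev i) ((𝔬 i).G U) ∧
      CoReadsGlob (GD i) 1 U (𝔬 i).blkY (𝔬 i).blk (ev i) ((𝔬 i).D U ∘ₗ (𝔬 i).G U) ∧
      CoReadsGlob (GD i) 2 U (𝔬 i).blk (𝔬 i).blkY (evY i) ((𝔬 i).G U ∘ₗ (𝔬 i).Dstar U) ∧
      CoReadsGlob (G₁ i) 0 U (𝔬 i).blk (𝔬 i).blk (ev i) ((𝔬 i).G1 U) ∧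
      CoReadsGlob (G₁ i) 1 U (𝔬 i).blkY (𝔬 i).blk (ev i) ((𝔬 i).D U ∘ₗ (𝔬 i).G1 U) ∧
      CoReadsGlob (G₁ i) 2 U (𝔬 i).blk (𝔬 i).blkY (evY i) ((𝔬 i).G1 U ∘ₗ (𝔬 i).Dstar U))
    (hl2N : ∀ (i : I) (U : (bg i).Cfg),
      (L2ReadsNbr (R := R₀ i) (H := H₀ i) (GD i) 0 U (Rel i) r Cev (𝔬 i).blk (𝔬 i).blk (ev i) ((𝔬 i).G U) ∧
        L2ReadsNbr (R := R₀ i) (H := H₀ i) (GD i) 1 U (Rel i) r Cev (𝔬 i).blkY (𝔬 i).blk (ev i) ((𝔬 i).D U ∘ₗ (𝔬 i).G U) ∧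
        L2ReadsNbr (R := R₀ i) (H := H₀ i) (GD i) 2 U (Rel i) r Cev (𝔬 i).blk (𝔬 i).blkY (evY i) ((𝔬 i).G U ∘ₗ (𝔬 i).Dstar U) ∧
        L2ReadsNbr (R := R₀ i) (H := H₀ i) (GD i) 3 U (Rel i) r Cev (𝔬 i).blkY (𝔬 i).blkY (evY i)
          ((𝔬 i).D U ∘ₗ ((𝔬 i).G U ∘ₗ (𝔬 i).Dstar U)) ∧
        L2ReadsNbr (R := R₀ i) (H := H₀ i) (GD i) 4 U (Rel i) r Cev ((𝔬 i).blk ∘ Prod.fst) (𝔬 i).blk (ev i)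
          (familyOp (fun q : P × P => (Dd i U q.1 ∘ₗ Dd i U q.2) ∘ₗ (𝔬 i).G U)) ∧
        L2ReadsNbr (R := R₀ i) (H := H₀ i) (GD i) 5 U (Rel i) r Cev ((𝔬 i).blk ∘ Prod.fst) (𝔬 i).blk (ev i)
          (familyOp (fun q : P × P => (𝔬 i).G U ∘ₗ (Dds i U q.1 ∘ₗ Dds i U q.2)))) ∧
      (L2ReadsNbr (R := R₀ i) (H := H₀ i) (G₁ i) 0 U (Rel i) r Cev (𝔬 i).blk (𝔬 i).blk (ev i) ((𝔬 i).G1 U) ∧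
        L2ReadsNbr (R := R₀ i) (H := H₀ i) (G₁ i) 1 U (Rel i) r Cev (𝔬 i).blkY (𝔬 i).blk (ev i) ((𝔬 i).D U ∘ₗ (𝔬 i).G1 U) ∧
        L2ReadsNbr (R := R₀ i) (H := H₀ i) (G₁ i) 2 U (Rel i) r Cev (𝔬 i).blk (𝔬 i).blkY (evY i) ((𝔬 i).G1 U ∘ₗ (𝔬 i).Dstar U) ∧
        L2ReadsNbr (R := R₀ i) (H := H₀ i) (G₁ i) 3 U (Rel i) r Cev (𝔬 i).blkY (𝔬 i).blkY (evY i)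
          ((𝔬 i).D U ∘ₗ ((𝔬 i).G1 U ∘ₗ (𝔬 i).Dstar U)) ∧
        L2ReadsNbr (R := R₀ i) (H := H₀ i) (G₁ i) 4 U (Rel i) r Cev ((𝔬 i).blk ∘ Prod.fst) (𝔬 i).blk (ev i)
          (familyOp (fun q : P × P => (Dd i U q.1 ∘ₗ Dd i U q.2) ∘ₗ (𝔬 i).G1 U)) ∧
        L2ReadsNbr (R := R₀ i) (H := H₀ i) (G₁ i) 5 U (Rel i) r Cev ((𝔬 i).blk ∘ Prod.fst) (𝔬 i).blk (ev i)
          (familyOp (fun q : P × P => (𝔬 i).G1 U ∘ₗ (Dds i U q.1 ∘ₗ Dds i U q.2)))))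
    (hH1N : ∀ (i : I) (U : (bg i).Cfg),
      H1ReadsNbr (GD i) U (𝔭 i) (Rel i) r (𝔬 i).blk (𝔬 i).blkY (ev i) (evY i) ((𝔬 i).D U ∘ₗ (𝔬 i).G U)
        ((𝔬 i).G U ∘ₗ (𝔬 i).Dstar U) ∧
      H1ReadsNbr (G₁ i) U (𝔭 i) (Rel i) r (𝔬 i).blk (𝔬 i).blkY (ev i) (evY i) ((𝔬 i).D U ∘ₗ (𝔬 i).G1 U)
        ((𝔬 i).G1 U ∘ₗ (𝔬 i).Dstar U))
    (hIN : ∀ (i : I) (U : (bg i).Cfg),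
      InputReadsNbr (GD i) U (𝔭 i) (bH i) r (𝔬 i).blkY (evY i) ((𝔬 i).D U ∘ₗ ((𝔬 i).G U ∘ₗ (𝔬 i).Dstar U)) ∧
      InputReadsNbr (G₁ i) U (𝔭 i) (bH i) r (𝔬 i).blkY (evY i) ((𝔬 i).D U ∘ₗ ((𝔬 i).G1 U ∘ₗ (𝔬 i).Dstar U)))
    (hHCN : ∀ (i : I) (U : (bg i).Cfg),
      CoReadsHHolderNbr (Hk i) U d (𝔭 i) r (𝔬 i).blkZ ((𝔬 i).D U ∘ₗ (𝔬 i).Hm U) ∧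
      CoReadsHHolderNbr (H₁k i) U d (𝔭 i) r (𝔬 i).blkZ ((𝔬 i).D U ∘ₗ (𝔬 i).H1m U))
    (hsym : ∀ i, M₁ ≤ (geo i).M → ∀ α₀ : ℝ, 0 < α₀ → (geo i).M * α₀ ≤ a₁ →
      ∀ U : (bg i).Cfg, (bg i).Reg335 c35 α₀ U → (bg i).Reg336 c35 α₀ U →
        (IsTransposePair ((𝔬 i).G U) ((𝔬 i).G U) ∧ IsTransposePair ((𝔬 i).G1 U) ((𝔬 i).G1 U)) ∧
        (IsTransposePair ((𝔬 i).D U ∘ₗ (𝔬 i).G U) ((𝔬 i).G U ∘ₗ (𝔬 i).Dstar U) ∧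
          IsTransposePair ((𝔬 i).D U ∘ₗ (𝔬 i).G1 U) ((𝔬 i).G1 U ∘ₗ (𝔬 i).Dstar U)))
    (hmodel : ∀ i, M₁ ≤ (geo i).M → ∀ α₀ : ℝ, 0 < α₀ → (geo i).M * α₀ ≤ a₁ →
      ∀ U : (bg i).Cfg, (bg i).Reg335 c35 α₀ U → (bg i).Reg336 c35 α₀ U →
        Thm33G0 (𝔬 i) (R₀ i) (H₀ i) B₀ δ₀ U ∧
        Step (𝔬 i) (R₀ i) (H₀ i) (hgeo i).lenle 1 (θ₁ * ((geo i).M * α₀)) δK U ∧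
        Step (𝔬 i) (R₀ i) (H₀ i) (hgeo i).lenle 2 (θ₁ * ((geo i).M * α₀)) δK U ∧
        FormSmall (𝔬 i) (r₁ * ((geo i).M * α₀)) U ∧ Identities (𝔬 i) U)
    (hleft : ∀ i, M₁ ≤ (geo i).M → ∀ α₀ : ℝ, 0 < α₀ → (geo i).M * α₀ ≤ a₁ →
      ∀ U : (bg i).Cfg, (bg i).Reg335 c35 α₀ U → (bg i).Reg336 c35 α₀ U →
        LeftStep (𝔬 i) (R₀ i) (H₀ i) (hgeo i).lenle B₀ δ₀ (θD * ((geo i).M * α₀)) δK U)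
    (hlettersH : ∀ i, M₁ ≤ (geo i).M → ∀ α₀ : ℝ, 0 < α₀ → (geo i).M * α₀ ≤ a₁ →
      ∀ U : (bg i).Cfg, (bg i).Reg335 c35 α₀ U → (bg i).Reg336 c35 α₀ U →
        LettersH (𝔬 i) (R₀ i) (H₀ i) (hgeo i) B₃ δ₃ U)
    (hG0C : ∀ i, M₁ ≤ (geo i).M → ∀ α₀ : ℝ, 0 < α₀ → (geo i).M * α₀ ≤ a₁ →
      ∀ U : (bg i).Cfg, (bg i).Reg335 c35 α₀ U → (bg i).Reg336 c35 α₀ U →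
        Thm33G0H (𝔬 i) (𝔭 i) (R₀ i) (H₀ i) (bH i) Bh Bi Bi2 δ₀ U ∧ Thm33G0L2P (𝔬 i) (Dd i) (Dds i) (R₀ i) (H₀ i) B₂ δ₀ U)
    (hstepC : ∀ i, M₁ ≤ (geo i).M → ∀ α₀ : ℝ, 0 < α₀ → (geo i).M * α₀ ≤ a₁ →
      ∀ U : (bg i).Cfg, (bg i).Reg335 c35 α₀ U → (bg i).Reg336 c35 α₀ U →
        StepH (𝔬 i) (𝔭 i) (R₀ i) (H₀ i) (bH i) (hgeo i).lenle (θH * ((geo i).M * α₀)) δK U ∧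
        StepL2 (𝔬 i) (R₀ i) (H₀ i) (θ₂ * ((geo i).M * α₀)) δK U)
    (hLHH : ∀ i, M₁ ≤ (geo i).M → ∀ α₀ : ℝ, 0 < α₀ → (geo i).M * α₀ ≤ a₁ →
      ∀ U : (bg i).Cfg, (bg i).Reg335 c35 α₀ U → (bg i).Reg336 c35 α₀ U →
        LettersHH (𝔬 i) (𝔭 i) (R₀ i) (H₀ i) (hgeo i).lenle Bq δ₃ U) :
    B9.Thm312Printed d c35 geo bg GD G₁ Hk H₁k (fun i => HasRWExpOfOps (𝔬 i)) (fun i => HasRWExpHOfOps (𝔬 i))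
      (fun i => PosDefKOfOps (𝔬 i)) := by
  -- thresholds and uniform constants
  obtain ⟨MLg, cg, hLg⟩ := hL21 ρ hρ
  set M₁' : ℝ := max (max M₁ ML) MLg with hM₁'
  have hM₁'pos : 0 < M₁' := lt_max_of_lt_left (lt_max_of_lt_left hM₁)
  have hle₁ : ∀ {i : I}, M₁' ≤ (geo i).M → M₁ ≤ (geo i).M := fun h => ((le_max_left _ _).trans (le_max_left _ _)).trans h
  have hleL : ∀ {i : I}, M₁' ≤ (geo i).M → ML ≤ (geo i).M := fun h => ((le_max_right _ _).trans (le_max_left _ _)).trans h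
  have hleg : ∀ {i : I}, M₁' ≤ (geo i).M → MLg ≤ (geo i).M := fun h => (le_max_right _ _).trans h
  have hθc : 0 ≤ θ₁ * c := mul_nonneg hθ₁ hc
  have hB₂c : 0 ≤ B₂ * θ₂ * c * c := mul_nonneg (mul_nonneg (mul_nonneg hB₂ hθ₂) hc) hc
  set a₁' : ℝ := min a₁ (min (2 * (θ₁ * c + 1))⁻¹ (2 * (B₂ * θ₂ * c * c + 1))⁻¹) with ha₁'
  have ha₁'pos : 0 < a₁' := lt_min ha₁ (lt_min (inv_pos.mpr (by linarith)) (inv_pos.mpr (by linarith)))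
  have ha₁'le : a₁' ≤ a₁ := min_le_left _ _
  have h1α : 0 < 1 - α := by linarith
  have hB33 : 0 ≤ B₃ * B₃ * c := mul_nonneg (mul_nonneg hB₃ hB₃) hc
  have hLc0 : 0 ≤ Lc := zero_le_one.trans hLc
  have hLc2 : 0 ≤ Lc ^ (2 : ℝ) := Real.rpow_nonneg hLc0 _
  set Λu : ℝ := Lc ^ (4 : ℝ) with hΛu
  have hΛu0 : 0 ≤ Λu := Real.rpow_nonneg hLc0 _
  set tH : ℝ := θH * a₁ with htH
  have htH0 : 0 ≤ tH := mul_nonneg hθH ha₁.le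
  set BL : ℝ := B₀ + θD * a₁ * (2 * B₀) * c with hBL
  have hBL0 : 0 ≤ BL := add_nonneg hB₀ (mul_nonneg (mul_nonneg (mul_nonneg hθD ha₁.le) (by linarith)) hc)
  set NP : ℝ := Real.sqrt (Fintype.card (P × P)) with hNP
  have hNP0 : 0 ≤ NP := Real.sqrt_nonneg _
  set KLu : ℝ := 2 * B₀ * Λu + (B₀ + θD * a₁ * (2 * B₀) * c + 2 * B₀) * Λu +
    (B₂ + B₂ * (θ₂ * a₁ * (2 * B₂) * c) * c) * (1 + NP * Λu + NP * Λu) with hKLu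
  have hm00 : (0 : ℝ) ≤ m := Nat.cast_nonneg m
  have hmN0 : (0 : ℝ) ≤ mN := Nat.cast_nonneg mN
  set Fr : ℝ := (mN : ℝ) * m * Cev * CL ^ 2 * Real.exp (r * ρf) with hFr
  have hFr0 : 0 ≤ Fr := mul_nonneg (mul_nonneg (mul_nonneg (mul_nonneg hmN0 hm00) hCev) (sq_nonneg _)) (Real.exp_nonneg _)
  set BL2 : ℝ := max (Fr * KLu) 0 with hBL2
  have hBL20 : 0 ≤ BL2 := le_max_right _ _
  -- the uniform Hölder constants (the first one also serves the Hölder member of (3.133))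
  set CH3 : ℝ := CL ^ 2 * Real.exp (r * ((1 - α) * ρ)) with hCH3
  have hCH30 : 0 ≤ CH3 := mul_nonneg (sq_nonneg _) (Real.exp_nonneg _)
  set BβH : ℝ → ℝ := fun β => CH3 * ((Bq β * B₃ * c + tH * (2 * (B₃ * B₃ * c)) * c) * Lc ^ (2 : ℝ)) with hBβH
  have hBβH0 : ∀ β, 0 ≤ BβH β := fun β =>
    mul_nonneg hCH30 (mul_nonneg (add_nonneg (mul_nonneg (mul_nonneg (hBq β) hB₃) hc) (mul_nonneg (mul_nonneg htH0 (by linarith)) hc)) hLc2)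
  set Bβo : ℝ → ℝ := fun β => max ((m : ℝ) * CL * Real.exp (r * ρf) * (Bh β + tH * (2 * B₀) * c)) (BβH β) with hBβo
  have hBβo0 : ∀ β, 0 ≤ Bβo β := fun β => (hBβH0 β).trans (le_max_right _ _)
  set Bεo : ℝ → ℝ := fun ε => max (Real.exp (r * ρf) * (Bi ε + BL * Λu * tH * c)) 0 with hBεo
  have hBεo0 : ∀ ε, 0 ≤ Bεo ε := fun ε => le_max_right _ _
  set Bεβo : ℝ → ℝ → ℝ := fun ε β => max (CL * Real.exp (r * ρf) * (Bi2 ε β + (Bh β + tH * (2 * B₀) * c) * Λu * tH * c)) 0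
    with hBεβo
  have hBεβo0 : ∀ ε β, 0 ≤ Bεβo ε β := fun ε β => le_max_right _ _
  refine thm312Printed_of_stepRelH 𝔬 R₀ H₀ GD G₁ Hk H₁k ev evY Rel m θ₁ θD r₁ B₀ δ₀ δK σ c ρ a₁' M₁' ML BL2 ρf B₃ δ₃ α Lc Bβo
    Bεo Bεβo hθ₁ hθD hr₁ hB₀ hB₃ hσ hρ hρS hρδ hρ₃ hc ha₁'pos hM₁'pos hρf hα hBβo0 hBεo0 hBεβo0 hgeo S hL1 hLle hη hrow hL21 hsat
    hmult hRdist hRlen hcoR hco1R hcoHR hcoG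
    (fun i hM α₀ hα₀ hMa U hU hU' => hmodel i (hle₁ hM) α₀ hα₀ (hMa.trans ha₁'le) U hU hU')
    (fun i hM α₀ hα₀ hMa U hU hU' => hleft i (hle₁ hM) α₀ hα₀ (hMa.trans ha₁'le) U hU hU')
    (fun i hM α₀ hα₀ hMa U hU hU' => hlettersH i (hle₁ hM) α₀ hα₀ (hMa.trans ha₁'le) U hU hU') ?_
  -- the residual, PROVED per member and per configuration
  intro i hM α₀ hα₀ hMa U hU hU'
  have hM₁i : M₁ ≤ (geo i).M := hle₁ hM
  have hMpos : 0 < (geo i).M := hM₁.trans_le hM₁i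
  have hm0 : 0 ≤ (geo i).M * α₀ := (mul_pos hMpos hα₀).le
  have hma₁ : (geo i).M * α₀ ≤ a₁ := hMa.trans ha₁'le
  have hmθ : (geo i).M * α₀ ≤ (2 * (θ₁ * c + 1))⁻¹ := hMa.trans ((min_le_right _ _).trans (min_le_left _ _))
  have hm₂ : (geo i).M * α₀ ≤ (2 * (B₂ * θ₂ * c * c + 1))⁻¹ := hMa.trans ((min_le_right _ _).trans (min_le_right _ _))
  obtain ⟨h33, hS1, hS2, -, hI⟩ := hmodel i hM₁i α₀ hα₀ hma₁ U hU hU'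
  have hLS := hleft i hM₁i α₀ hα₀ hma₁ U hU hU'
  have hLH := hlettersH i hM₁i α₀ hα₀ hma₁ U hU hU'
  obtain ⟨hH0, hL2s⟩ := hG0C i hM₁i α₀ hα₀ hma₁ U hU hU'
  obtain ⟨hStH, hStL⟩ := hstepC i hM₁i α₀ hα₀ hma₁ U hU hU'
  have hHH := hLHH i hM₁i α₀ hα₀ hma₁ U hU hU'
  have hrowi := hrow i (hleL hM)
  obtain ⟨h260, -, hsize⟩ := hLg i (hleg hM)
  obtain ⟨⟨hlD0, hlD1, hlD2, hlD3, hlD4, hlD5⟩, ⟨hl10, hl11, hl12, hl13, hl14, hl15⟩⟩ := hl2N i U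
  obtain ⟨hH1D, hH11⟩ := hH1N i U
  obtain ⟨hIRD, hIR1⟩ := hIN i U
  obtain ⟨hHC0, hHC1⟩ := hHCN i U
  obtain ⟨⟨hsymG, hsymG1⟩, ⟨htrG, htrG1⟩⟩ := hsym i hM₁i α₀ hα₀ hma₁ U hU hU'
  have hlen := (hgeo i).lenle
  -- the second-argument saturation of d from the first-argument one and the symmetry of d
  have hRd₂ : ∀ a b b' : (geo i).Site, Rel i b b' → (geo i).dist a b = (geo i).dist a b' := fun a b b' h => by
    rw [(hgeo i).symm a b, (hgeo i).symm a b', hRdist i b b' a h]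
  set θ : ℝ := θ₁ * ((geo i).M * α₀) with hθdef
  set θ' : ℝ := θD * ((geo i).M * α₀) with hθ'def
  set θH' : ℝ := θH * ((geo i).M * α₀) with hθH'def
  set θ₂' : ℝ := θ₂ * ((geo i).M * α₀) with hθ₂'def
  have hθ : 0 ≤ θ := mul_nonneg hθ₁ hm0
  have hθ' : 0 ≤ θ' := mul_nonneg hθD hm0
  have hθH' : 0 ≤ θH' := mul_nonneg hθH hm0
  have hθ₂' : 0 ≤ θ₂' := mul_nonneg hθ₂ hm0
  have hq : θ * c ≤ 1 / 2 := by
    have h := small_aux₁₃ hθc hmθ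
    calc θ * c = θ₁ * c * ((geo i).M * α₀) := by rw [hθdef]; ring
      _ ≤ 1 / 2 := h
  have hq1 : θ * c < 1 := lt_one_of_le_half hq
  have hq₂ : B₂ * θ₂' * c * c ≤ 1 / 2 := by
    have h := small_aux₁₃ hB₂c hm₂
    calc B₂ * θ₂' * c * c = B₂ * θ₂ * c * c * ((geo i).M * α₀) := by rw [hθ₂'def]; ring
      _ ≤ 1 / 2 := h
  have hq₂1 : B₂ * θ₂' * c * c < 1 := lt_one_of_le_half hq₂
  have hinv0 : 0 ≤ (1 - θ * c)⁻¹ := inv_nonneg.mpr (sub_nonneg.mpr hq1.le)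
  have hinv2 : (1 - θ * c)⁻¹ ≤ 2 := inv_one_sub_le_two hq
  have hC0 : 0 ≤ B₀ * (1 - θ * c)⁻¹ := mul_nonneg hB₀ hinv0
  have hθ'le : θ' ≤ θD * a₁ := mul_le_mul_of_nonneg_left hma₁ hθD
  have hθH'le : θH' ≤ tH := mul_le_mul_of_nonneg_left hma₁ hθH
  have hθ₂'le : θ₂' ≤ θ₂ * a₁ := mul_le_mul_of_nonneg_left hma₁ hθ₂
  have hC1L : B₀ + θ' * (B₀ * (1 - θ * c)⁻¹) * c ≤ BL := by
    have h2 : θ' * (B₀ * (1 - θ * c)⁻¹) ≤ θD * a₁ * (2 * B₀) :=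
      mul_le_mul hθ'le (const_le_two_mul hB₀ hq) hC0 (mul_nonneg hθD ha₁.le)
    have h3 : θ' * (B₀ * (1 - θ * c)⁻¹) * c ≤ θD * a₁ * (2 * B₀) * c := mul_le_mul_of_nonneg_right h2 hc
    rw [hBL]; linarith
  -- the scale transfers of p. 398 at (ρ, α) and the uniform bound of their constants
  have hL0i : 0 < (geo i).L := lt_of_lt_of_le one_pos (hL1 i)
  have hL4 : (geo i).L ^ (4 : ℝ) ≤ Λu := Real.rpow_le_rpow hL0i.le (hLle i) (by norm_num)
  have hST : ∀ γ : ℝ, |γ| ≤ 4 → ScaleTransfer (geo i) ρ α ((geo i).L ^ |γ|) (fun y => (geo i).len y ^ γ) ∧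
      0 ≤ (geo i).L ^ |γ| ∧ (geo i).L ^ |γ| ≤ Λu := fun γ hγ =>
    ⟨scaleTransfer_rpow_of_260 h260 hsize (hL1 i) (hη i) γ hγ, Real.rpow_nonneg hL0i.le _,
      (B9Ineq347AllEntries.size_condition_compact (geo i).L γ _ (hL1 i) hγ hsize).2.trans hL4⟩
  obtain ⟨hST1, hΛ₁0, hΛ₁le⟩ := hST 1 (by norm_num)
  obtain ⟨hSTh, hΛh0, hΛhle⟩ := hST (1 / 2) (by rw [abs_of_nonneg (by norm_num : (0 : ℝ) ≤ 1 / 2)]; norm_num)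
  obtain ⟨hSTm, hΛm0, hΛmle⟩ := hST (-1) (by norm_num)
  have hST2 : ScaleTransfer (geo i) ρ α (Lc ^ (2 : ℝ)) (fun y => (geo i).len y ^ (2 : ℝ)) := by
    obtain ⟨h2, _, _⟩ := hST 2 (by norm_num)
    have hΛle : (geo i).L ^ |(2 : ℝ)| ≤ Lc ^ (2 : ℝ) := by
      rw [abs_of_pos (by norm_num : (0 : ℝ) < 2)]
      exact Real.rpow_le_rpow hL0i.le (hLle i) (by norm_num)
    exact fun y y' => (h2 y y').trans (mul_le_mul_of_nonneg_right hΛle (B9Ineq347AllEntries.weight_nonneg (geo i) hL0i (hη i) 2 y))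
  -- the uniform bounds of the member constants of the two blocks
  have hKL : constL2N B₀ θ θ' B₂ θ₂' c ((geo i).L ^ |(1 : ℝ)|) ((geo i).L ^ |(1 / 2 : ℝ)|) ((geo i).L ^ |(-1 : ℝ)|) NP ≤ KLu :=
    constL2N_le hB₀ hB₂ hc hθ' hθ'le hθ₂' hθ₂'le hq hq₂ hNP0 hΛ₁0 hΛ₁le hΛh0 hΛhle hΛm0 hΛmle
  have hKL2 : Fr * constL2N B₀ θ θ' B₂ θ₂' c ((geo i).L ^ |(1 : ℝ)|) ((geo i).L ^ |(1 / 2 : ℝ)|) ((geo i).L ^ |(-1 : ℝ)|) NP ≤ BL2 :=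
    (mul_le_mul_of_nonneg_left hKL hFr0).trans (le_max_left _ _)
  have hBhA : ∀ β, Bh β + θH' * (B₀ * (1 - θ * c)⁻¹) * c ≤ Bh β + tH * (2 * B₀) * c := fun β => by
    have h := mul_le_mul_of_nonneg_right (mul_le_mul hθH'le (const_le_two_mul hB₀ hq) hC0 htH0) hc
    linarith
  have hmCE : 0 ≤ (m : ℝ) * CL * Real.exp (r * ρf) := mul_nonneg (mul_nonneg hm00 (zero_le_one.trans hCL1)) (Real.exp_nonneg _)
  have hβo : ∀ β, 0 ≤ β → β < 1 →
      (m : ℝ) * CL * Real.exp (r * ρf) * (Bh β + θH' * (B₀ * (1 - θ * c)⁻¹) * c) ≤ Bβo β ∧ 0 ≤ Bβo β := fun β _ _ =>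
    ⟨(mul_le_mul_of_nonneg_left (hBhA β) hmCE).trans (le_max_left _ _), hBβo0 β⟩
  have hεo : ∀ ε, 0 < ε → ε ≤ 1 →
      Real.exp (r * ρf) * (Bi ε + (B₀ + θ' * (B₀ * (1 - θ * c)⁻¹) * c) * (geo i).L ^ |(1 : ℝ)| * θH' * c) ≤ Bεo ε ∧ 0 ≤ Bεo ε := by
    intro ε h0 h1
    have h : (B₀ + θ' * (B₀ * (1 - θ * c)⁻¹) * c) * (geo i).L ^ |(1 : ℝ)| * θH' * c ≤ BL * Λu * tH * c :=
      mul_le_mul_of_nonneg_right (mul_le_mul (mul_le_mul hC1L hΛ₁le hΛ₁0 hBL0) hθH'le hθH' (mul_nonneg hBL0 hΛu0)) hc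
    refine ⟨le_trans ?_ (le_max_left _ _), hBεo0 ε⟩
    exact mul_le_mul_of_nonneg_left (by linarith) (Real.exp_nonneg _)
  have hεβo : ∀ ε β, 0 < ε → ε ≤ 1 → 0 ≤ β → β < 1 →
      CL * Real.exp (r * ρf) * (Bi2 ε β + (Bh β + θH' * (B₀ * (1 - θ * c)⁻¹) * c) * (geo i).L ^ |(1 : ℝ)| * θH' * c) ≤ Bεβo ε β ∧
        0 ≤ Bεβo ε β := by
    intro ε β hε0 hε1 h0 h1
    have hA0 : 0 ≤ Bh β + θH' * (B₀ * (1 - θ * c)⁻¹) * c := add_nonneg (hBh β h0 h1) (mul_nonneg (mul_nonneg hθH' hC0) hc)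
    have hA1 : 0 ≤ Bh β + tH * (2 * B₀) * c := hA0.trans (hBhA β)
    have h : (Bh β + θH' * (B₀ * (1 - θ * c)⁻¹) * c) * (geo i).L ^ |(1 : ℝ)| * θH' * c ≤ (Bh β + tH * (2 * B₀) * c) * Λu * tH * c :=
      mul_le_mul_of_nonneg_right (mul_le_mul (mul_le_mul (hBhA β) hΛ₁le hΛ₁0 hA1) hθH'le hθH' (mul_nonneg hA1 hΛu0)) hc
    refine ⟨le_trans ?_ (le_max_left _ _), hBεβo0 ε β⟩
    exact mul_le_mul_of_nonneg_left (by linarith) (mul_nonneg (zero_le_one.trans hCL1) (Real.exp_nonneg _))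
  -- the two blocks of a kernel family co-read by A ∈ {G, G₁} (with (Δ_a − T)A = I), proved and weakened to the uniform constants
  have resK : ∀ (K : B9.KernelFamily (geo i) (bg i)) (A T : Module.End ℝ (X i → ℝ)), ((𝔬 i).S0 U - T) * A = 1 →
      HasMaj (cNorm (R₀ i) (H₀ i) (𝔬 i).blk (hgeo i).lenle 1) (cNorm (R₀ i) (H₀ i) (𝔬 i).blk (hgeo i).lenle 1) ((𝔬 i).G0 U ∘ₗ T)
        (fun a b => θ * Real.exp (-(δK * (geo i).dist a b))) →
      HasMaj (cNorm (R₀ i) (H₀ i) (𝔬 i).blk (hgeo i).lenle 2) (cNorm (R₀ i) (H₀ i) (𝔬 i).blk (hgeo i).lenle 2) ((𝔬 i).G0 U ∘ₗ T)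
        (fun a b => θ * Real.exp (-(δK * (geo i).dist a b))) →
      HasMaj (cNorm (R₀ i) (H₀ i) (𝔬 i).blk (hgeo i).lenle 2) (cNorm (R₀ i) (H₀ i) (𝔬 i).blkY (hgeo i).lenle 1)
        ((𝔬 i).D U ∘ₗ (𝔬 i).G0 U ∘ₗ T) (fun a b => θ' * Real.exp (-(δK * (geo i).dist a b))) →
      (∀ β : ℝ, 0 ≤ β → β < 1 → HasMaj (cNormR (R₀ i) (H₀ i) (𝔬 i).blk (hgeo i).lenle (-2))
        (cNormR (R₀ i) (H₀ i) (𝔭 i).blkPY (hgeo i).lenle (β - 1)) (((𝔭 i).ΦY U β ∘ₗ (𝔬 i).D U ∘ₗ (𝔬 i).G0 U) ∘ₗ T)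
        (fun a b => θH' * Real.exp (-(δK * (geo i).dist a b)))) →
      (∀ β : ℝ, 0 ≤ β → β < 1 → HasMaj (cNormR (R₀ i) (H₀ i) (𝔬 i).blk (hgeo i).lenle (-1))
        (cNormR (R₀ i) (H₀ i) (𝔭 i).blkPX (hgeo i).lenle (β - 1)) (((𝔭 i).ΦX U β ∘ₗ (𝔬 i).G0 U) ∘ₗ T)
        (fun a b => θH' * Real.exp (-(δK * (geo i).dist a b)))) →
      (∀ ε : ℝ, 0 < ε → HasMaj (bH i ε) (cNormR (R₀ i) (H₀ i) (𝔬 i).blk (hgeo i).lenle 1) (T ∘ₗ ((𝔬 i).G0 U ∘ₗ (𝔬 i).Dstar U))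
        (fun a b => θH' * Real.exp (-(δK * (geo i).dist a b)))) →
      BlockBd (g := toB6 (geo i) (R₀ i) (H₀ i)) (𝔬 i).blk (𝔬 i).blk T
        (fun (y y' : (geo i).Site) => θ₂' * ((geo i).len y)⁻¹ * ((geo i).len y')⁻¹ * Real.exp (-(δK * (geo i).dist y y'))) →
      IsTransposePair A A → IsTransposePair ((𝔬 i).D U ∘ₗ A) (A ∘ₗ (𝔬 i).Dstar U) →
      L2ReadsNbr (R := R₀ i) (H := H₀ i) K 0 U (Rel i) r Cev (𝔬 i).blk (𝔬 i).blk (ev i) A →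
      L2ReadsNbr (R := R₀ i) (H := H₀ i) K 1 U (Rel i) r Cev (𝔬 i).blkY (𝔬 i).blk (ev i) ((𝔬 i).D U ∘ₗ A) →
      L2ReadsNbr (R := R₀ i) (H := H₀ i) K 2 U (Rel i) r Cev (𝔬 i).blk (𝔬 i).blkY (evY i) (A ∘ₗ (𝔬 i).Dstar U) →
      L2ReadsNbr (R := R₀ i) (H := H₀ i) K 3 U (Rel i) r Cev (𝔬 i).blkY (𝔬 i).blkY (evY i) ((𝔬 i).D U ∘ₗ (A ∘ₗ (𝔬 i).Dstar U)) →
      L2ReadsNbr (R := R₀ i) (H := H₀ i) K 4 U (Rel i) r Cev ((𝔬 i).blk ∘ Prod.fst) (𝔬 i).blk (ev i)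
        (familyOp (fun q : P × P => (Dd i U q.1 ∘ₗ Dd i U q.2) ∘ₗ A)) →
      L2ReadsNbr (R := R₀ i) (H := H₀ i) K 5 U (Rel i) r Cev ((𝔬 i).blk ∘ Prod.fst) (𝔬 i).blk (ev i)
        (familyOp (fun q : P × P => A ∘ₗ (Dds i U q.1 ∘ₗ Dds i U q.2))) →
      H1ReadsNbr K U (𝔭 i) (Rel i) r (𝔬 i).blk (𝔬 i).blkY (ev i) (evY i) ((𝔬 i).D U ∘ₗ A) (A ∘ₗ (𝔬 i).Dstar U) →
      InputReadsNbr K U (𝔭 i) (bH i) r (𝔬 i).blkY (evY i) ((𝔬 i).D U ∘ₗ (A ∘ₗ (𝔬 i).Dstar U)) →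
      L2Block K BL2 ρf U ∧ B9.Ineq343_345 K Bβo Bεo Bεβo ρf U := by
    intro K A T hIA hK1 hK2 hKD hpY hpX htD hT2 hsymA htrA hl0 hl1 hl2 hl3 hl4 hl5 hH1 hIRA
    have hl2B := l2Block_of_step_nbrRec (hgeo i) (𝔬 i) (Dd i) (Dds i) (Rel i) (ev i) (evY i) hrowi hθ hθ' hθ₂' hB₀ hB₂ hσ hα0 hρ.le
      hρS hρδ hq1 hq₂1 hρf.le hρf1 hρf2 hΛ₁0 hΛh0 hΛm0 hST1 hSTh hSTm hI.invG0' hIA h33.e0 hLS.e1 h33.e2 hL2s hK1 hK2 hKD hT2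
      hsymA htrA hRd₂ (hmult i) (hnbr i) hCL1 (hCL i) hCev hl0 hl1 hl2 hl3 hl4 hl5
    have hHo := holder_of_step_nbr (hgeo i) (𝔬 i) (𝔭 i) (bH i) (Rel i) (ev i) (evY i) hrowi hθ hθ' hθH' hB₀ hσ hα0 hρ.le hρS hρδ
      hq1 hρf.le hρf1 hΛ₁0 hBh hBi hBi2 hST1 hI.invG0' hIA h33.e0 hLS.e1 h33.e2 hH0 hK1 hK2 hKD hpY hpX htD hRd₂ (hmult i) hCL1
      (hCL i) hH1 hIRA
    exact ⟨l2Block_mono (S i) hl2B hKL2 hBL20 le_rfl, ineq343_345_mono_on (S i) hHo (hgeo i).lenpos hβo hεo hεβo le_rfl⟩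
  -- the Hölder member of (3.133) for H = A∘Q*∘C, proved and weakened to the uniform constant and the rate ρ_f ∕ 2
  have hfix := fix_of_inverses hI.invG0' hI.invG
  have hfix1 := fix_of_inverses hI.invG0' hI.invG1
  have hKH0 : 0 ≤ B₃ * B₃ * c * (1 - θ * c)⁻¹ := mul_nonneg hB33 hinv0
  have hH0m : HasMaj (cNorm (R₀ i) (H₀ i) (𝔬 i).blkZ (hgeo i).lenle 2) (cNorm (R₀ i) (H₀ i) (𝔬 i).blk (hgeo i).lenle 2) ((𝔬 i).Hm U)
      (fun a b => B₃ * B₃ * c * (1 - θ * c)⁻¹ * Real.exp (-(ρ * (geo i).dist a b))) := by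
    rw [hI.eq126]
    exact H_entry0 (hgeo i) hrowi hc hθ hB₃ hσ hρ.le hρ₃ hρδ hS2.step hLH.gQs2 hLH.c2 hfix hq1
  have hH10m : HasMaj (cNorm (R₀ i) (H₀ i) (𝔬 i).blkZ (hgeo i).lenle 2) (cNorm (R₀ i) (H₀ i) (𝔬 i).blk (hgeo i).lenle 2) ((𝔬 i).H1m U)
      (fun a b => B₃ * B₃ * c * (1 - θ * c)⁻¹ * Real.exp (-(ρ * (geo i).dist a b))) := by
    rw [hI.eq129]
    exact H_entry0 (hgeo i) hrowi hc hθ hB₃ hσ hρ.le hρ₃ hρδ hS2.step1 hLH.gQs2 hLH.c12 hfix1 hq1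
  have hα1 : α ≤ 1 := by linarith
  have resH : ∀ {Hk'' : B9.HKernel (geo i) (bg i)} (β : ℝ) (ζ : (geo i).Cut) (y y' : (geo i).Site),
      (∀ (ζ : (geo i).Cut) (y y' : (geo i).Site), (geo i).cutInT ζ y →
        Hk''.h U β ζ y' ≤ (CL ^ 2 * Real.exp (r * ((1 - α) * ρ)) * ((Bq β * B₃ * c + θH' * (B₃ * B₃ * c * (1 - θ * c)⁻¹) * c) *
          Lc ^ (2 : ℝ))) * (geo i).cutH β ζ * ((geo i).len y) ^ (-(1 + β)) * ((geo i).len y') ^ (-(d : ℝ)) *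
          Real.exp (-((1 - α) * ρ * (geo i).dist y y'))) →
      (geo i).cutInT ζ y →
      Hk''.h U β ζ y' ≤ Bβo β * (geo i).cutH β ζ * ((geo i).len y) ^ (-(1 + β)) * ((geo i).len y') ^ (-(d : ℝ)) *
        Real.exp (-(ρf / 2 * (geo i).dist y y')) := by
    intro Hk'' β ζ y y' h hζ
    refine (h ζ y y' hζ).trans ?_
    -- the member constant below the uniform one
    have hCle : CL ^ 2 * Real.exp (r * ((1 - α) * ρ)) * ((Bq β * B₃ * c + θH' * (B₃ * B₃ * c * (1 - θ * c)⁻¹) * c) * Lc ^ (2 : ℝ)) ≤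
        Bβo β := by
      have h1 : B₃ * B₃ * c * (1 - θ * c)⁻¹ ≤ 2 * (B₃ * B₃ * c) := by
        have := mul_le_mul_of_nonneg_left hinv2 hB33; linarith
      have h2 : θH' * (B₃ * B₃ * c * (1 - θ * c)⁻¹) * c ≤ tH * (2 * (B₃ * B₃ * c)) * c :=
        mul_le_mul_of_nonneg_right (mul_le_mul hθH'le h1 hKH0 htH0) hc
      have h3 : (Bq β * B₃ * c + θH' * (B₃ * B₃ * c * (1 - θ * c)⁻¹) * c) * Lc ^ (2 : ℝ) ≤
          (Bq β * B₃ * c + tH * (2 * (B₃ * B₃ * c)) * c) * Lc ^ (2 : ℝ) := mul_le_mul_of_nonneg_right (by linarith) hLc2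
      exact (mul_le_mul_of_nonneg_left h3 hCH30).trans (le_max_right _ _)
    -- the rate ρ_f ∕ 2 below (1 − α)ρ
    have hrate : Real.exp (-((1 - α) * ρ * (geo i).dist y y')) ≤ Real.exp (-(ρf / 2 * (geo i).dist y y')) :=
      Real.exp_le_exp.mpr (neg_le_neg (mul_le_mul_of_nonneg_right (by linarith) ((hgeo i).dnn y y')))
    have hnn : 0 ≤ (geo i).cutH β ζ * ((geo i).len y) ^ (-(1 + β)) * ((geo i).len y') ^ (-(d : ℝ)) :=
      mul_nonneg (mul_nonneg ((S i).cutH_nonneg β ζ) (Real.rpow_nonneg (hlen y) _)) (Real.rpow_nonneg (hlen y') _)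
    calc CL ^ 2 * Real.exp (r * ((1 - α) * ρ)) * ((Bq β * B₃ * c + θH' * (B₃ * B₃ * c * (1 - θ * c)⁻¹) * c) * Lc ^ (2 : ℝ)) *
          (geo i).cutH β ζ * ((geo i).len y) ^ (-(1 + β)) * ((geo i).len y') ^ (-(d : ℝ)) * Real.exp (-((1 - α) * ρ * (geo i).dist y y'))
        = CL ^ 2 * Real.exp (r * ((1 - α) * ρ)) * ((Bq β * B₃ * c + θH' * (B₃ * B₃ * c * (1 - θ * c)⁻¹) * c) * Lc ^ (2 : ℝ)) *
            ((geo i).cutH β ζ * ((geo i).len y) ^ (-(1 + β)) * ((geo i).len y') ^ (-(d : ℝ))) *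
            Real.exp (-((1 - α) * ρ * (geo i).dist y y')) := by ring
      _ ≤ Bβo β * ((geo i).cutH β ζ * ((geo i).len y) ^ (-(1 + β)) * ((geo i).len y') ^ (-(d : ℝ))) *
            Real.exp (-(ρf / 2 * (geo i).dist y y')) :=
          mul_le_mul (mul_le_mul_of_nonneg_right hCle hnn) hrate (Real.exp_nonneg _) (mul_nonneg (hBβo0 β) hnn)
      _ = Bβo β * (geo i).cutH β ζ * ((geo i).len y) ^ (-(1 + β)) * ((geo i).len y') ^ (-(d : ℝ)) *
            Real.exp (-(ρf / 2 * (geo i).dist y y')) := by ring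
  refine ⟨fun K hK => ?_, fun Hk' hK' β ζ y y' h0 h1 hζ => ?_⟩
  · have hK2 : K = GD i ∨ K = G₁ i := by simpa using hK
    rcases hK2 with rfl | rfl
    · exact resK _ _ _ hI.invG hS1.step hS2.step hLS.stepD hStH.pY hStH.pX hStH.tD hStL.t hsymG htrG hlD0 hlD1 hlD2 hlD3 hlD4 hlD5
        hH1D hIRD
    · exact resK _ _ _ hI.invG1 hS1.step1 hS2.step1 hLS.stepD1 hStH.pY1 hStH.pX1 hStH.tD1 hStL.t1 hsymG1 htrG1 hl10 hl11 hl12 hl13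
        hl14 hl15 hH11 hIR1
  · have hK2 : Hk' = Hk i ∨ Hk' = H₁k i := by simpa using hK'
    rcases hK2 with rfl | rfl
    · exact resH β ζ y y' (hkh_of_step_nbr (hgeo i) (𝔭 i) hrowi hθH' (hBq β) hB₃ hKH0 hLc2 hσ hρ.le hρ₃ hρδ hα1 h0 h1.le hHC0 hCL1
        (hCL i) hST2 (hHH.pQ β h0 h1) hLH.c2 (hStH.pY β h0 h1) hH0m hI.eq126 hfix) hζ
    · exact resH β ζ y y' (hkh_of_step_nbr (hgeo i) (𝔭 i) hrowi hθH' (hBq β) hB₃ hKH0 hLc2 hσ hρ.le hρ₃ hρδ hα1 h0 h1.le hHC1 hCL1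
        (hCL i) hST2 (hHH.pQ β h0 h1) hLH.c12 (hStH.pY1 β h0 h1) hH10m hI.eq129 hfix1) hζ

end Family

end

end Literature.MathematicalPhysics.QuantumFieldTheory.Balaban1983to89.B9Thm312WholeLeafCompleteNbrRec
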